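import Summits.QuantumFields.YangMills.Theorems.BalabanUVNodesN16KingModelBlockMeanShift
import Summits.QuantumFields.YangMills.Theorems.BalabanUVNodesN18KingModelTorusDeriv
import Summits.QuantumFields.YangMills.Theorems.BalabanUVNodesN18KingModelScalesPair

/-!
# Route «BalabanUVNodes» (K3⁵ `SpineGivenEndpointR13SepCoP`), DAG node N16 = NE3 — THE KING-MODEL RUNG OF NE3, DERIVATIVE LINE,
# PART 2: the LATTICE DERIVATIVE of the two-run minimiser discrepancy «run A's minimiser vs run B's minimiser block-averaged
# back to run A's lattice» has a GEOMETRIC RATE with ONE level-free (and volume-free) constant — King 1986 Prop. 3.8 (3.71)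
# line 2 + line 4 (Hölder modulus of the derivative) + Thm 3.3, BY NAME — the scalar template of NE3's conjunct (Lip₁ᶜ)

Cell `pub-ymgap`, seat `pub-ymgap-dag-n16-c` (R134 acceleration seat, strategy s1; HUMAN RULING D-0062; chair R424 venue), generation 8.
`--kind proof --supports stmt-QuantumFields-20296 --as helper` (K3⁵, plan g68 KEY-20 ∕ dag-lead WORDS-141).  `bears_on: R4∕N16 · row «R2^ϱ,
the unprinted core»`.

WHY THIS FILE.  The statement of record of node N16, `NE3EnergyWeightedCovShape.NE3EnergyRateWCov`, asks — inside one `∃ (u, Z)` per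
level — for the VALUE of the two-run discrepancy direction `Z` (`U_A^u = W·e^Z`, `W = rescale L (bavg L U_B)`) at a geometric rate
AND for its first covariant differences (Lip₁ᶜ) `‖Ad(W)Z(x + e_μ) − Z(x)‖ ≤ Λ₁·ξ²` one power of `ξ = L^{−k}` better.  Generation 7
(`BalabanUVNodesN16KingModelTwoRun`) typed the value in King's `A = 0` scalar model (`D = φ_k^ψ − Q_nφ_{k+n}^ψ`, sup norm, rate
`(L^{−γ∕2})^k`).  THIS file types the scalar template of (Lip₁ᶜ): the LATTICE DERIVATIVE `∂^η_μD(x) = Lᵏ·(D(x + e_μ) − D(x))` of the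
discrepancy decays at the same geometric rate — i.e. the raw first difference `D(x + e_μ) − D(x)` is `O(L^{−k}·(L^{−γ∕2})^k)`, one
power of the lattice spacing better than `D`, exactly the pattern (Lip₁ᶜ) postulates.  Inputs BY NAME: King's (3.71) line 2 for the
actual operators (`MinimizerTwoSpacingDeriv.king_prop38_deriv_torus(_blocks)`, seat n18-b; constants made level-free by seat n18-a's
`N18KingModelTorusDeriv.dprop38Const_le_unif` ∕ `douterRate_le_unif`), the block-mean ∕ difference commutation of PART 1
(`N16KingModelBlockShift.coarseDeriv_blockMean_eq`: the derivative of the block mean is the double mean of the fine derivatives at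
`x′ + j·e_μ`, `x′` over `x`, `j < Lⁿ`), and — because those fine points lie over `x` OR over `x + e_μ` (`over_add_nsmul_cases`) while
line 2 compares with `∂^η_μℋ_k` at the coarse point BELOW — King's (3.71) line 4 ∕ Thm 3.3 (3.8): the Hölder-`s` modulus of
`∂^η_μℋ_k` (`MinimizerHolderDecay.abs_holderS_dkernel_le_unif`, `holder_dkernel_decay_blocks`, seat n18-b) at the neighbour distance
`|x + e_μ − x| = L^{−k}` (`tdistT_add_unitVec_eq_one`), which costs `(L^{−s})^k`; with `s = γ` (resp. `α = γ∕2`) the rate is unchanged.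

WHAT THIS FILE PROVES (kernel; theorems only — 0 `def`, 0 sorry; `ℋ_k = minimiser Lᵏ M a_k (Lᵏ)² m²` King's ACTUAL operator, fibre and
block mean `Q_n` spelled INLINE as in generation 7):
* §1 `abs_le_of_holder_bound`, `holdist_add_unitVec` (`|x + e_μ − x|_∞ = L^{−k}` in unit coordinates), ★ `dkernel_neighbour_le`
  (`|∂^η_μℋ_k(x + e_μ, b) − ∂^η_μℋ_k(x, b)| ≤ H_s(a_k)·(Lᵏ)^{−s}`, every volume, `0 ≤ s < 1`), `abs_rangeMean_sub_le`, `datum_expand`.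
* §2 ★ `twoRunDeriv_kernel_blockMean_le` — EVERY volume `M`, odd `L ≥ 2`, `k, n ≥ 1`, `a, m² > 0`, `0 ≤ γ < 1`, every `b, x, μ`:
  `|∂^η_μ(ℋ_k(·, b) − Q_nℋ_{k+n}(·, b))(x)| ≤ (C₅′(a, L, d, γ) + H_γ(a))·(L^{−γ})^k`, `C₅′ = dprop38RateConst a a Θ (π²∕4)^d d γ +
  dprop38PosConst a (π²∕4)^d d γ` (n18-a's uniform constant), `H_γ(a) = (π∕2)^d·[(π²∕4)^{d+1}·2d^γπ^{1+γ} + a(π²∕4)·2d^γ·C(d, γ)]`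
  (n18-b's Hölder-`γ` constant); ★ `twoRunDeriv_minimiser_blockMean_le_l1` — the datum form `… ≤ (C₅′ + H_γ)·(L^{−γ})^k·Σ_b|ψ(b)|`.
* The SUP-NORM form on BAŁABAN's VOLUMES (`M_μ = 2Lᵐ`) with King's decay and ONE level- and volume-free constant,
  `|∂^η_μ(φ_K^ψ − Q_nφ_{K+n}^ψ)(x)| ≤ (2√(2ac₀C₅′)·K_d(δ₀∕2) + 2c₁K_d(δ₁))·(L^{−γ∕2})^K·sup|ψ|`, is the sequel file
  `BalabanUVNodesN16KingModelTwoRunDerivSup` (`twoRunDeriv_minimiser_blockMean_le_sup`).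

READING FOR ROW N16 (a dictionary, NOT a decl): NE3's (Lip₁ᶜ) `‖Ad(W(x+e_κ)μ)Z(x+e_μ)κ − Z x κ‖ ≤ Λ₁ξ²` ↔ `|D(x + e_μ) − D(x)| =
L^{−K}·|∂^η_μD(x)| ≤ C·L^{−K}·(L^{−γ∕2})^K·S` (abelian: `Ad = id`, no transport); the extra power of `ξ` in (Lip₁ᶜ) ↔ the lattice-spacing
factor `η = L^{−K}` of the unit-coordinate derivative.  WHAT THE MODEL DOES NOT CARRY: the gauge `u`, the parallel transport `Ad(W)`,
the covariant block average, the second-difference conjunct (Lip₂′ᶜ) (its template would be (3.71) line 4 for `D`, not typed here),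
Bałaban's sharp axial constraint — everything non-abelian.

HONEST FRAMING.  A MODEL LAYER (template literature: [King1986] is printed AND proved; re-proved here in kernel from the tree's King
files BY NAME): the mechanism (Lip₁ᶜ) postulates for Bałaban's covariant minimisers holds, with content (`θ = L^{−γ∕2} < 1`, one
constant for all levels and volumes), for King's `A = 0` scalar minimisers.  NOTHING of [Balaban1985RegularSpaces] ∕ [Balaban1985Variational]
is proved or discharged; N16 ∕ NE3 is NOT discharged (in-edges N05 — [B8] Thm 4 ∕ Prop 3 at the pinned all-torus members — and N07 —
[B11] Thm 1 (8)+(10) — remain hypotheses of the chain of record); COUNT UNMOVED; count-neutral; one finite torus at a time — NOT ℝ⁴,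
NOT infinite volume, NOT OS, NOT a mass gap, NOT Clay.

Sources: C. King, *The U(1) Higgs model. I. The continuum limit*, Commun. Math. Phys. **102** (1986) 649–677 [King1986], Prop. 3.8
(3.71) p. 664 (lines 2 and 4), Thm 3.3 (3.7)–(3.8) p. 658, Prop. 3.7 (3.64)–(3.65) p. 663, §4 (4.19)–(4.27) pp. 672–674; T. Bałaban,
*Regularity and decay of lattice Green's functions*, Commun. Math. Phys. **89** (1983) 571–597 [Balaban1983RegularityDecay], Thm (1.10)
p. 573 clause 2 (the source of King's Thm 3.3 derivative clause, certified on the torus by `B4Thm110ZeroTorus`).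
-/

set_option autoImplicit false

noncomputable section

open Real Finset
open scoped BigOperators

namespace Summit.QuantumFields.YangMills.BalabanUVNodes.N16KingModelDeriv

open Literature.MathematicalPhysics.QuantumFieldTheory.Balaban1983to89 (Params)
open Literature.MathematicalPhysics.QuantumFieldTheory.Balaban1983to89.B5Prop11Plancherel (Tor fine unitVec)
open Literature.MathematicalPhysics.QuantumFieldTheory.Balaban1983to89.B4Sect5Proof (latticeConst latticeConst_nonneg)
open Literature.MathematicalPhysics.QuantumFieldTheory.King1986
  (aK aK_pos aK_le lemma43Const dprop38RateConst dprop38PosConst aliasConst)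
open Literature.MathematicalPhysics.QuantumFieldTheory.King1986.Torus
  (minimiser blockOf tdistT tdistT_nonneg tdistT_sumBound holdist king_prop38_deriv_torus king_prop38_deriv_torus_blocks
    abs_holderS_dkernel_le_unif holder_dkernel_decay_blocks)
open Summit.QuantumFields.YangMills.BalabanUVNodes.N18KingModel (rpow_neg_natPow kingTheta_pos)
open Summit.QuantumFields.YangMills.BalabanUVNodes.N18KingModelTorusDeriv (dprop38Const_le_unif douterRate_le_unif)
open Summit.QuantumFields.YangMills.BalabanUVNodes.N18KingModelScalesPair (aliasConst_nonneg_of_lt_one)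
open Summit.QuantumFields.YangMills.BalabanUVNodes.N16KingModel
  (mem_overFib overFib_nonempty abs_blockMean_sub_le blockMean_sum_mul minimiser_apply_eq_sum)
open Summit.QuantumFields.YangMills.BalabanUVNodes.N16KingModelBlockShift
  (tdistT_add_unitVec_eq_one over_add_nsmul_cases coarseDeriv_blockMean_eq)

variable {d : ℕ}

/-! ## §1 The Hölder patch at the neighbour distance `L^{−k}`, a range-mean inequality, and the linear expansion in the datum -/

/-- From a Hölder-quotient bound `|h^{−s}·D| ≤ C` at a positive distance `h` to `|D| ≤ C·h^s`. [folklore] -/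
theorem abs_le_of_holder_bound {h D C s : ℝ} (hh : 0 < h) (hb : |h ^ (-s) * D| ≤ C) : |D| ≤ C * h ^ s := by
  rw [abs_mul, abs_of_pos (Real.rpow_pos_of_pos hh _), Real.rpow_neg hh.le,
    inv_mul_le_iff₀ (Real.rpow_pos_of_pos hh s)] at hb
  rw [mul_comm]; exact hb

/-- **Neighbours are at unit-coordinate distance exactly `N⁻¹`**: `holdist N M (x + e_μ) x = N⁻¹` (`N·M_μ ≥ 2`;
`N16KingModelBlockShift.tdistT_add_unitVec_eq_one`). [folklore] -/
theorem holdist_add_unitVec {N : ℕ} [NeZero N] {M : Fin d → ℕ} [∀ μ, NeZero (M μ)] {μ : Fin d} (hNM : 2 ≤ N * M μ)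
    (x : Tor (fine N M)) : holdist N M (x + unitVec (fine N M) μ) x = ((N : ℝ))⁻¹ := by
  unfold holdist
  rw [tdistT_add_unitVec_eq_one (fine N M) (μ := μ) hNM x, one_div]

/-- ★ **THE HÖLDER PATCH**: the lattice derivative of King's minimiser kernel changes by at most `H_s(a)·N^{−s}` between NEIGHBOURING
fine points — (3.71) line 4's Hölder-`s` modulus `abs_holderS_dkernel_le_unif` (every unit torus, uniform in `N`, `0 ≤ s < 1`) read at the
neighbour distance `|x + e_μ − x|_∞ = N⁻¹`: for odd `N ≥ 2`, `a, m² > 0`, all `b, x, μ`,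
`|∂^η_μℋ(x + e_μ, b) − ∂^η_μℋ(x, b)| ≤ (π∕2)^d·[(π²∕4)^{d+1}·2d^sπ^{1+s} + a(π²∕4)·2d^s·C(d, s)]·N^{−s}`, `∂^η_μℋ(z, b) = N·(ℋ(z + e_μ, b) − ℋ(z, b))`,
`ℋ = minimiser N M a N² m²`. [cite: King1986, Prop. 3.8 (3.71) p.664 (line 4), (3.62) p.663, (4.19)–(4.22) p.672] -/
theorem dkernel_neighbour_le (hd : 0 < d) {N : ℕ} [NeZero N] (hN : Odd N) (hN2 : 2 ≤ N) (M : Fin d → ℕ) [∀ μ, NeZero (M μ)]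
    {a m2 : ℝ} (ha : 0 < a) (hm : 0 < m2) {s : ℝ} (hs0 : 0 ≤ s) (hs1 : s < 1) (b : Tor M) (x : Tor (fine N M)) (μ : Fin d) :
    |(N : ℝ) * (minimiser N M a ((N : ℝ) ^ 2) m2 (Pi.single b 1) (x + unitVec (fine N M) μ + unitVec (fine N M) μ)
          - minimiser N M a ((N : ℝ) ^ 2) m2 (Pi.single b 1) (x + unitVec (fine N M) μ))
        - (N : ℝ) * (minimiser N M a ((N : ℝ) ^ 2) m2 (Pi.single b 1) (x + unitVec (fine N M) μ)
          - minimiser N M a ((N : ℝ) ^ 2) m2 (Pi.single b 1) x)|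
      ≤ (π / 2) ^ d * ((π ^ 2 / 4) ^ d * (π ^ 2 / 4) * (2 * (d : ℝ) ^ s * π ^ (s + 1))
          + a * (π ^ 2 / 4) * (2 * (d : ℝ) ^ s) * aliasConst d s) * (N : ℝ) ^ (-s) := by
  have hM1 : 1 ≤ M μ := Nat.one_le_iff_ne_zero.mpr (NeZero.ne (M μ))
  have hNM : 2 ≤ N * M μ := hN2.trans (Nat.le_mul_of_pos_right N hM1)
  have hNpos : (0 : ℝ) < N := by exact_mod_cast (show 0 < N by omega)
  have h := abs_holderS_dkernel_le_unif hd hN (by omega) M ha hm hs0 hs1 b (x + unitVec (fine N M) μ) x μ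
  rw [holdist_add_unitVec hNM x] at h
  have h2 := abs_le_of_holder_bound (inv_pos.2 hNpos) h
  rwa [Real.inv_rpow hNpos.le, ← Real.rpow_neg hNpos.le] at h2

/-- The averaging inequality for a mean over `range R` spelled with `R⁻¹`. [folklore] -/
theorem abs_rangeMean_sub_le {R : ℕ} (hR : 0 < R) {g : ℕ → ℝ} {t C : ℝ} (h : ∀ j ∈ Finset.range R, |g j - t| ≤ C) :
    |((R : ℝ))⁻¹ * ∑ j ∈ Finset.range R, g j - t| ≤ C := by
  have h' := abs_blockMean_sub_le (s := Finset.range R) ⟨0, by simp [hR]⟩ h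
  rwa [Finset.card_range] at h'

/-- `e^{−δ·min(t₁, t₂)} ≤ e^{−δt₁} + e^{−δt₂}`. [folklore] -/
theorem exp_neg_mul_min_le (δ t₁ t₂ : ℝ) :
    Real.exp (-(δ * min t₁ t₂)) ≤ Real.exp (-(δ * t₁)) + Real.exp (-(δ * t₂)) := by
  rcases min_choice t₁ t₂ with h | h <;> rw [h]
  · linarith [Real.exp_pos (-(δ * t₂))]
  · linarith [Real.exp_pos (-(δ * t₁))]

/-- **Linear expansion in the datum** of the derivative of the two-run discrepancy: King's minimiser map is linear in `ψ`
(`N16KingModel.minimiser_apply_eq_sum`) and so are block means (`blockMean_sum_mul`), hence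
`t·((φ_A^ψ(x₁) − Q φ_B^ψ(x₁)) − (φ_A^ψ(x₀) − Q′ φ_B^ψ(x₀))) = Σ_b ψ(b)·t·((ℋ_A(x₁,b) − Qℋ_B(x₁,b)) − (ℋ_A(x₀,b) − Q′ℋ_B(x₀,b)))` for any two
finite averaging sets `F₁, F₀`. [cite: King1986, (2.13)–(2.15) p.653, (4.2) p.670] -/
theorem datum_expand (N N' : ℕ) [NeZero N] [NeZero N'] (M : Fin d → ℕ) [∀ μ, NeZero (M μ)] (aA cA aB cB m2 t : ℝ)
    (ψ : Tor M → ℝ) (x₁ x₀ : Tor (fine N M)) (F₁ F₀ : Finset (Tor (fine N' M))) :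
    t * ((minimiser N M aA cA m2 ψ x₁ - ((F₁.card : ℝ))⁻¹ * ∑ y ∈ F₁, minimiser N' M aB cB m2 ψ y)
          - (minimiser N M aA cA m2 ψ x₀ - ((F₀.card : ℝ))⁻¹ * ∑ y ∈ F₀, minimiser N' M aB cB m2 ψ y))
      = ∑ b, ψ b * (t * ((minimiser N M aA cA m2 (Pi.single b 1) x₁
            - ((F₁.card : ℝ))⁻¹ * ∑ y ∈ F₁, minimiser N' M aB cB m2 (Pi.single b 1) y)
          - (minimiser N M aA cA m2 (Pi.single b 1) x₀
            - ((F₀.card : ℝ))⁻¹ * ∑ y ∈ F₀, minimiser N' M aB cB m2 (Pi.single b 1) y))) := by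
  have hA1 := minimiser_apply_eq_sum N M aA cA m2 ψ x₁
  have hA0 := minimiser_apply_eq_sum N M aA cA m2 ψ x₀
  have hB : ∀ F : Finset (Tor (fine N' M)),
      ((F.card : ℝ))⁻¹ * ∑ y ∈ F, minimiser N' M aB cB m2 ψ y
        = ∑ b, ψ b * (((F.card : ℝ))⁻¹ * ∑ y ∈ F, minimiser N' M aB cB m2 (Pi.single b 1) y) := by
    intro F
    rw [← blockMean_sum_mul]
    refine congrArg _ (Finset.sum_congr rfl fun y _ => ?_)
    exact minimiser_apply_eq_sum N' M aB cB m2 ψ y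
  rw [hA1, hA0, hB F₁, hB F₀, ← Finset.sum_sub_distrib, ← Finset.sum_sub_distrib, ← Finset.sum_sub_distrib, Finset.mul_sum]
  refine Finset.sum_congr rfl fun b _ => ?_
  ring

/-! ## §2 ★ EVERY VOLUME: the derivative of the two-run kernel ∕ minimiser discrepancy after block averaging -/

section EveryVolume

variable {L : ℕ} [NeZero L] (M : Fin d → ℕ) [∀ μ, NeZero (M μ)]

/-- ★ **THE DERIVATIVE OF THE TWO-RUN KERNEL DISCREPANCY AFTER BLOCK AVERAGING** (every volume `M`, odd `L ≥ 2`, `k, n ≥ 1`, `a, m² > 0`,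
`0 ≤ γ < 1`): with `ℋ_k(x, b)` on `T_η = Tor (fine Lᵏ M)`, `ℋ_{k+n}` on `T_{η′} = Tor (fine (LⁿLᵏ) M)` (King's ACTUAL operators, `a_k = aK a L k`,
`c = η⁻²`), the block mean `(Q_ng)(x) = |Bⁿ(x)|⁻¹Σ_{x′ over x} g(x′)` and `D_b(x) = ℋ_k(x, b) − (Q_nℋ_{k+n}(·, b))(x)`, for every `b, x, μ`:
`|Lᵏ·(D_b(x + e_μ) − D_b(x))| ≤ (C₅′(a, L, d, γ) + H_γ(a))·(L^{−γ})^k`.  Proof: PART 1's commutation writes `Lᵏ·(Q_nℋ_{k+n}(x + e_μ) −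
Q_nℋ_{k+n}(x))` as the double mean of `∂^{η′}_μℋ_{k+n}(x′ + j·e_μ)`; each such fine point lies over `x` — King's (3.71) line 2
(`king_prop38_deriv_torus`) — or over `x + e_μ` — line 2 at `x + e_μ` plus the Hölder patch `dkernel_neighbour_le` at `s = γ`; the
`k, n`-dependence of King's constant is majorised by `dprop38Const_le_unif`, `a_k ≤ a`, and `(Lᵏ)^{−γ} = (L^{−γ})^k`.
[cite: King1986, Prop. 3.8 (3.71) p.664, §4 pp.670–674] -/
theorem twoRunDeriv_kernel_blockMean_le (hd : 0 < d) (hLodd : Odd L) (hL : 2 ≤ L) {k n : ℕ} (hk : 1 ≤ k) (hn : 1 ≤ n)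
    {a m2 : ℝ} (ha : 0 < a) (hm : 0 < m2) {γ : ℝ} (hγ0 : 0 ≤ γ) (hγ1 : γ < 1) (b : Tor M) (x : Tor (fine (L ^ k) M))
    (μ : Fin d) :
    |((L ^ k : ℕ) : ℝ) *
        ((minimiser (L ^ k) M (aK a L k) (((L ^ k : ℕ) : ℝ) ^ 2) m2 (Pi.single b 1) (x + unitVec (fine (L ^ k) M) μ)
            - (((Finset.univ.filter fun y : Tor (fine (L ^ n * L ^ k) M) =>
                  ∀ ν, ((x + unitVec (fine (L ^ k) M) μ) ν).val = (y ν).val / L ^ n).card : ℝ))⁻¹ *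
              ∑ y ∈ (Finset.univ.filter fun y : Tor (fine (L ^ n * L ^ k) M) =>
                  ∀ ν, ((x + unitVec (fine (L ^ k) M) μ) ν).val = (y ν).val / L ^ n),
                minimiser (L ^ n * L ^ k) M (aK a L (k + n)) (((L ^ n * L ^ k : ℕ) : ℝ) ^ 2) m2 (Pi.single b 1) y)
          - (minimiser (L ^ k) M (aK a L k) (((L ^ k : ℕ) : ℝ) ^ 2) m2 (Pi.single b 1) x
            - (((Finset.univ.filter fun x' : Tor (fine (L ^ n * L ^ k) M) =>
                  ∀ ν, (x ν).val = (x' ν).val / L ^ n).card : ℝ))⁻¹ *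
              ∑ x' ∈ (Finset.univ.filter fun x' : Tor (fine (L ^ n * L ^ k) M) => ∀ ν, (x ν).val = (x' ν).val / L ^ n),
                minimiser (L ^ n * L ^ k) M (aK a L (k + n)) (((L ^ n * L ^ k : ℕ) : ℝ) ^ 2) m2 (Pi.single b 1) x'))|
      ≤ ((dprop38RateConst a a (a * (2 * ((a * (1 - ((L : ℝ) ^ 2)⁻¹))⁻¹ + π ^ 2 / 48 + 1 / 3))) ((π ^ 2 / 4) ^ d) d γ
            + dprop38PosConst a ((π ^ 2 / 4) ^ d) d γ)
          + (π / 2) ^ d * ((π ^ 2 / 4) ^ d * (π ^ 2 / 4) * (2 * (d : ℝ) ^ γ * π ^ (γ + 1))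
            + a * (π ^ 2 / 4) * (2 * (d : ℝ) ^ γ) * aliasConst d γ)) * ((L : ℝ) ^ (-γ)) ^ k := by
  -- elementary facts
  have hL0 : 0 < L := by omega
  have hLr : (1 : ℝ) < L := by exact_mod_cast (lt_of_lt_of_le one_lt_two hL)
  have hLn : 0 < L ^ n := pow_pos hL0 n
  have hNodd : Odd (L ^ k) := hLodd.pow
  have hN2 : 2 ≤ L ^ k := by
    calc 2 ≤ L := hL
      _ = L ^ 1 := (pow_one L).symm
      _ ≤ L ^ k := Nat.pow_le_pow_right hL0 hk
  have haK : 0 < aK a L k := aK_pos ha hLr hk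
  have haKle : aK a L k ≤ a := aK_le ha hLr hk
  have hAC : 0 ≤ aliasConst d γ := aliasConst_nonneg_of_lt_one hd hγ1
  have hr : 0 ≤ ((L ^ k : ℕ) : ℝ) ^ (-γ) := Real.rpow_nonneg (Nat.cast_nonneg _) _
  -- names for the constants
  set Ck : ℝ := dprop38RateConst a a (lemma43Const a L k n) ((π ^ 2 / 4) ^ d) d γ
    + dprop38PosConst a ((π ^ 2 / 4) ^ d) d γ with hCk
  set Cu : ℝ := dprop38RateConst a a (a * (2 * ((a * (1 - ((L : ℝ) ^ 2)⁻¹))⁻¹ + π ^ 2 / 48 + 1 / 3))) ((π ^ 2 / 4) ^ d) d γ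
    + dprop38PosConst a ((π ^ 2 / 4) ^ d) d γ with hCu
  set Hk : ℝ := (π / 2) ^ d * ((π ^ 2 / 4) ^ d * (π ^ 2 / 4) * (2 * (d : ℝ) ^ γ * π ^ (γ + 1))
    + aK a L k * (π ^ 2 / 4) * (2 * (d : ℝ) ^ γ) * aliasConst d γ) with hHk
  set Hu : ℝ := (π / 2) ^ d * ((π ^ 2 / 4) ^ d * (π ^ 2 / 4) * (2 * (d : ℝ) ^ γ * π ^ (γ + 1))
    + a * (π ^ 2 / 4) * (2 * (d : ℝ) ^ γ) * aliasConst d γ) with hHu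
  have hCle : Ck ≤ Cu := dprop38Const_le_unif hd ha hL hk hn hγ1
  have hHk0 : 0 ≤ Hk := by
    have h1 : 0 ≤ aK a L k * (π ^ 2 / 4) * (2 * (d : ℝ) ^ γ) * aliasConst d γ :=
      mul_nonneg (mul_nonneg (mul_nonneg haK.le (by positivity)) (by positivity)) hAC
    have h2 : 0 ≤ (π ^ 2 / 4) ^ d * (π ^ 2 / 4) * (2 * (d : ℝ) ^ γ * π ^ (γ + 1)) := by positivity
    exact mul_nonneg (by positivity) (add_nonneg h2 h1)
  have hHle : Hk ≤ Hu := by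
    have h1 : aK a L k * (π ^ 2 / 4) * (2 * (d : ℝ) ^ γ) * aliasConst d γ
        ≤ a * (π ^ 2 / 4) * (2 * (d : ℝ) ^ γ) * aliasConst d γ :=
      mul_le_mul_of_nonneg_right (mul_le_mul_of_nonneg_right (mul_le_mul_of_nonneg_right haKle (by positivity))
        (by positivity)) hAC
    exact mul_le_mul_of_nonneg_left (add_le_add le_rfl h1) (by positivity)
  -- the pointwise bound at every fine point `x' + j·e_μ` read by the derivative of the block mean
  have hpt : ∀ x' : Tor (fine (L ^ n * L ^ k) M), (∀ ν, (x ν).val = (x' ν).val / L ^ n) → ∀ j ∈ Finset.range (L ^ n),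
      |((L ^ n * L ^ k : ℕ) : ℝ) *
          (minimiser (L ^ n * L ^ k) M (aK a L (k + n)) (((L ^ n * L ^ k : ℕ) : ℝ) ^ 2) m2 (Pi.single b 1)
              (x' + j • unitVec (fine (L ^ n * L ^ k) M) μ + unitVec (fine (L ^ n * L ^ k) M) μ)
            - minimiser (L ^ n * L ^ k) M (aK a L (k + n)) (((L ^ n * L ^ k : ℕ) : ℝ) ^ 2) m2 (Pi.single b 1)
              (x' + j • unitVec (fine (L ^ n * L ^ k) M) μ))
        - ((L ^ k : ℕ) : ℝ) *
          (minimiser (L ^ k) M (aK a L k) (((L ^ k : ℕ) : ℝ) ^ 2) m2 (Pi.single b 1) (x + unitVec (fine (L ^ k) M) μ)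
            - minimiser (L ^ k) M (aK a L k) (((L ^ k : ℕ) : ℝ) ^ 2) m2 (Pi.single b 1) x)|
        ≤ Ck * ((L ^ k : ℕ) : ℝ) ^ (-γ) + Hk * ((L ^ k : ℕ) : ℝ) ^ (-γ) := by
    intro x' hx' j hj
    have hjlt : j < L ^ n := Finset.mem_range.1 hj
    rcases over_add_nsmul_cases x x' hx' μ hjlt with h0 | h1
    · have h := king_prop38_deriv_torus hd hLodd hL hk hn M ha hm hγ0 hγ1 b x _ h0 μ
      exact h.trans (le_add_of_nonneg_right (mul_nonneg hHk0 hr))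
    · have h := king_prop38_deriv_torus hd hLodd hL hk hn M ha hm hγ0 hγ1 b (x + unitVec (fine (L ^ k) M) μ) _ h1 μ
      have hH := dkernel_neighbour_le hd hNodd hN2 M haK hm hγ0 hγ1 b x μ
      exact (abs_sub_le _ _ _).trans (add_le_add h hH)
  -- rewrite the derivative of the block mean with PART 1's commutation identity and average the pointwise bound
  have hrew : ∀ A1 Q1 A0 Q0 : ℝ, ((L ^ k : ℕ) : ℝ) * ((A1 - Q1) - (A0 - Q0))
      = ((L ^ k : ℕ) : ℝ) * (A1 - A0) - ((L ^ k : ℕ) : ℝ) * (Q1 - Q0) := by intros; ring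
  rw [hrew, coarseDeriv_blockMean_eq M x μ
    (minimiser (L ^ n * L ^ k) M (aK a L (k + n)) (((L ^ n * L ^ k : ℕ) : ℝ) ^ 2) m2 (Pi.single b 1)), abs_sub_comm]
  have hmean := abs_blockMean_sub_le (overFib_nonempty (by omega) k n M x) fun x' hx' =>
    abs_rangeMean_sub_le hLn (hpt x' (mem_overFib.1 hx'))
  refine hmean.trans ?_
  rw [← add_mul, rpow_neg_natPow]
  exact mul_le_mul_of_nonneg_right (add_le_add hCle hHle) (pow_nonneg (kingTheta_pos (by omega) γ).le k)

/-- ★ **THE DERIVATIVE OF THE TWO-RUN MINIMISER DISCREPANCY AFTER BLOCK AVERAGING — DATUM FORM, EVERY VOLUME**: for every datum `ψ` on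
the unit torus, coarse point `x` and direction `μ`, with `φ_k^ψ = minimiser Lᵏ M a_k (Lᵏ)² m² ψ` (run A), `φ_{k+n}^ψ` (run B) and the `n`-fold
block mean `Q_n` over the fibre: `|∂^η_μ(φ_k^ψ − Q_nφ_{k+n}^ψ)(x)| ≤ (C₅′ + H_γ)·(L^{−γ})^k·Σ_b|ψ(b)|` — linearity in the datum (`datum_expand`)
over `twoRunDeriv_kernel_blockMean_le`.  NE3's (Lip₁ᶜ) IN KING's MODEL, `ℓ¹`-datum form. [cite: King1986, Prop. 3.8 (3.71) p.664, (2.13)–(2.15) p.653] -/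
theorem twoRunDeriv_minimiser_blockMean_le_l1 (hd : 0 < d) (hLodd : Odd L) (hL : 2 ≤ L) {k n : ℕ} (hk : 1 ≤ k) (hn : 1 ≤ n)
    {a m2 : ℝ} (ha : 0 < a) (hm : 0 < m2) {γ : ℝ} (hγ0 : 0 ≤ γ) (hγ1 : γ < 1) (ψ : Tor M → ℝ)
    (x : Tor (fine (L ^ k) M)) (μ : Fin d) :
    |((L ^ k : ℕ) : ℝ) *
        ((minimiser (L ^ k) M (aK a L k) (((L ^ k : ℕ) : ℝ) ^ 2) m2 ψ (x + unitVec (fine (L ^ k) M) μ)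
            - (((Finset.univ.filter fun y : Tor (fine (L ^ n * L ^ k) M) =>
                  ∀ ν, ((x + unitVec (fine (L ^ k) M) μ) ν).val = (y ν).val / L ^ n).card : ℝ))⁻¹ *
              ∑ y ∈ (Finset.univ.filter fun y : Tor (fine (L ^ n * L ^ k) M) =>
                  ∀ ν, ((x + unitVec (fine (L ^ k) M) μ) ν).val = (y ν).val / L ^ n),
                minimiser (L ^ n * L ^ k) M (aK a L (k + n)) (((L ^ n * L ^ k : ℕ) : ℝ) ^ 2) m2 ψ y)
          - (minimiser (L ^ k) M (aK a L k) (((L ^ k : ℕ) : ℝ) ^ 2) m2 ψ x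
            - (((Finset.univ.filter fun x' : Tor (fine (L ^ n * L ^ k) M) =>
                  ∀ ν, (x ν).val = (x' ν).val / L ^ n).card : ℝ))⁻¹ *
              ∑ x' ∈ (Finset.univ.filter fun x' : Tor (fine (L ^ n * L ^ k) M) => ∀ ν, (x ν).val = (x' ν).val / L ^ n),
                minimiser (L ^ n * L ^ k) M (aK a L (k + n)) (((L ^ n * L ^ k : ℕ) : ℝ) ^ 2) m2 ψ x'))|
      ≤ ((dprop38RateConst a a (a * (2 * ((a * (1 - ((L : ℝ) ^ 2)⁻¹))⁻¹ + π ^ 2 / 48 + 1 / 3))) ((π ^ 2 / 4) ^ d) d γ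
            + dprop38PosConst a ((π ^ 2 / 4) ^ d) d γ)
          + (π / 2) ^ d * ((π ^ 2 / 4) ^ d * (π ^ 2 / 4) * (2 * (d : ℝ) ^ γ * π ^ (γ + 1))
            + a * (π ^ 2 / 4) * (2 * (d : ℝ) ^ γ) * aliasConst d γ)) * ((L : ℝ) ^ (-γ)) ^ k * ∑ b, |ψ b| := by
  set C : ℝ := ((dprop38RateConst a a (a * (2 * ((a * (1 - ((L : ℝ) ^ 2)⁻¹))⁻¹ + π ^ 2 / 48 + 1 / 3))) ((π ^ 2 / 4) ^ d) d γ
            + dprop38PosConst a ((π ^ 2 / 4) ^ d) d γ)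
          + (π / 2) ^ d * ((π ^ 2 / 4) ^ d * (π ^ 2 / 4) * (2 * (d : ℝ) ^ γ * π ^ (γ + 1))
            + a * (π ^ 2 / 4) * (2 * (d : ℝ) ^ γ) * aliasConst d γ)) * ((L : ℝ) ^ (-γ)) ^ k with hC
  rw [datum_expand]
  calc _ ≤ ∑ b, |ψ b * (((L ^ k : ℕ) : ℝ) *
          ((minimiser (L ^ k) M (aK a L k) (((L ^ k : ℕ) : ℝ) ^ 2) m2 (Pi.single b 1) (x + unitVec (fine (L ^ k) M) μ)
              - (((Finset.univ.filter fun y : Tor (fine (L ^ n * L ^ k) M) =>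
                    ∀ ν, ((x + unitVec (fine (L ^ k) M) μ) ν).val = (y ν).val / L ^ n).card : ℝ))⁻¹ *
                ∑ y ∈ (Finset.univ.filter fun y : Tor (fine (L ^ n * L ^ k) M) =>
                    ∀ ν, ((x + unitVec (fine (L ^ k) M) μ) ν).val = (y ν).val / L ^ n),
                  minimiser (L ^ n * L ^ k) M (aK a L (k + n)) (((L ^ n * L ^ k : ℕ) : ℝ) ^ 2) m2 (Pi.single b 1) y)
            - (minimiser (L ^ k) M (aK a L k) (((L ^ k : ℕ) : ℝ) ^ 2) m2 (Pi.single b 1) x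
              - (((Finset.univ.filter fun x' : Tor (fine (L ^ n * L ^ k) M) =>
                    ∀ ν, (x ν).val = (x' ν).val / L ^ n).card : ℝ))⁻¹ *
                ∑ x' ∈ (Finset.univ.filter fun x' : Tor (fine (L ^ n * L ^ k) M) => ∀ ν, (x ν).val = (x' ν).val / L ^ n),
                  minimiser (L ^ n * L ^ k) M (aK a L (k + n)) (((L ^ n * L ^ k : ℕ) : ℝ) ^ 2) m2 (Pi.single b 1) x')))| :=
        Finset.abs_sum_le_sum_abs _ _
    _ ≤ ∑ b, |ψ b| * C := by
        refine Finset.sum_le_sum fun b _ => ?_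
        rw [abs_mul]
        exact mul_le_mul_of_nonneg_left (twoRunDeriv_kernel_blockMean_le M hd hLodd hL hk hn ha hm hγ0 hγ1 b x μ)
          (abs_nonneg _)
    _ = C * ∑ b, |ψ b| := by rw [← Finset.sum_mul, mul_comm]

end EveryVolume

end Summit.QuantumFields.YangMills.BalabanUVNodes.N16KingModelDeriv

end
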